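import Mathlib
import Summits.NavierStokesRegularity.NavierStokesRegularity.Theorems.FilamentSkeletonRssStadiumKernelPieces
import Summits.NavierStokesRegularity.NavierStokesRegularity.Theorems.FilamentSkeletonRssStadiumChordCrude

/-!
# Kernel bound from a principal-branch margin, and clamped contour data (`TangentSkeletonNearStraightL`, stmt-NavierStokesRegularity-23320,
# registered stub `stub_stripPropagation` — the `hdom`/continuity inputs of Theorems.StadiumFixedSourcePiece for blueprint item R2)

* `kernel_norm_le_of_margin` : if `Re w ≥ m₀ > 0` then `‖(w^{3/2})⁻¹ • (D ⨯₃ V)‖ ≤ m₀^{−3/2}·(2‖D‖‖V‖)` — with the uniform margin of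
  Theorems.StadiumBaseMargin and `‖F z − F ζ‖ ≤ M‖z − ζ‖` (Theorems.StadiumChordCrude) this is the constant dominating function on the (bounded)
  plateau / connector parameter sets.
* `kernel_norm_le_of_margin_chord` : the same with `V = F z − F ζ`, `‖D‖ ≤ M`, `‖z − ζ‖ ≤ R`: `≤ m₀^{−3/2}·2M²R`.
* `continuous_clamp` : the clamp `t ↦ max a (min t b)` is continuous (and the identity on `[a,b]`: `min_eq_left`/`max_eq_right`; cf. `Literature.MathematicalPhysics.KineticTheory.clamp_eq_self`) — used to extend the plateau data
  `t ↦ F(t + iy₀)` continuously to all of `ℝ` as Theorems.StadiumFixedSourcePiece requires (`Continuous P`), without changing the set integral.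
HONEST FRAMING: a tool for a HYPOTHETICAL filament skeleton on the NEGATIVE side of a MODEL route; nothing here bears on Navier–Stokes regularity or
blow-up.  `--supports stmt-NavierStokesRegularity-23320`.
-/

set_option linter.dupNamespace false

noncomputable section

namespace Summit.NavierStokesRegularity.NavierStokesRegularity.Theorems.StadiumMarginKernel

open Set Metric
open scoped Matrix
open Summit.NavierStokesRegularity.NavierStokesRegularity.Theorems.StadiumKernelPieces
open Summit.NavierStokesRegularity.NavierStokesRegularity.Theorems.StadiumChordCrude

/-- **Kernel bound from a margin.** [folklore] -/
theorem kernel_norm_le_of_margin {w : ℂ} {m₀ : ℝ} (hm₀ : 0 < m₀) (hw : m₀ ≤ w.re) (D V : Fin 3 → ℂ) :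
    ‖(w ^ ((3:ℂ) / 2))⁻¹ • (D ⨯₃ V)‖ ≤ m₀ ^ (-(3/2 : ℝ)) * (2 * ‖D‖ * ‖V‖) := by
  have hwpos : 0 < w.re := lt_of_lt_of_le hm₀ hw
  have hker : ‖(w ^ ((3:ℂ) / 2))⁻¹‖ ≤ m₀ ^ (-(3/2 : ℝ)) :=
    (norm_inv_cpow_threeHalves_le hwpos).trans (Real.rpow_le_rpow_of_nonpos hm₀ hw (by norm_num))
  rw [norm_smul]
  exact mul_le_mul hker (norm_crossProduct_le D V) (norm_nonneg _) (Real.rpow_nonneg hm₀.le _)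

/-- **Kernel bound from a margin and the chord Lipschitz bound**: `Re w ≥ m₀`, `‖D‖ ≤ M`, `F` differentiable with `‖F′‖ ≤ M` on the segment
`[ζ, z]`, `‖z − ζ‖ ≤ R`: `‖(w^{3/2})⁻¹ • (D ⨯₃ (F z − F ζ))‖ ≤ m₀^{−3/2}·(2M²R)`. [folklore] -/
theorem kernel_norm_le_of_margin_chord {w : ℂ} {m₀ M R : ℝ} (hm₀ : 0 < m₀) (hw : m₀ ≤ w.re) {D : Fin 3 → ℂ} (hD : ‖D‖ ≤ M)
    {F : ℂ → (Fin 3 → ℂ)} {z ζ : ℂ} (hF : ∀ u ∈ segment ℝ ζ z, DifferentiableAt ℂ F u)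
    (hM : ∀ u ∈ segment ℝ ζ z, ‖deriv F u‖ ≤ M) (hR : ‖z - ζ‖ ≤ R) :
    ‖(w ^ ((3:ℂ) / 2))⁻¹ • (D ⨯₃ (F z - F ζ))‖ ≤ m₀ ^ (-(3/2 : ℝ)) * (2 * M ^ 2 * R) := by
  have h1 := kernel_norm_le_of_margin hm₀ hw D (F z - F ζ)
  have h2 : ‖F z - F ζ‖ ≤ M * ‖z - ζ‖ := norm_sub_le_of_segment hF hM
  have hM0 : 0 ≤ M := (norm_nonneg _).trans hD
  have h3 : 2 * ‖D‖ * ‖F z - F ζ‖ ≤ 2 * M ^ 2 * R := by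
    have h4 : ‖F z - F ζ‖ ≤ M * R := h2.trans (mul_le_mul_of_nonneg_left hR hM0)
    calc 2 * ‖D‖ * ‖F z - F ζ‖ ≤ 2 * M * (M * R) :=
          mul_le_mul (mul_le_mul_of_nonneg_left hD (by norm_num)) h4 (norm_nonneg _) (by positivity)
      _ = 2 * M ^ 2 * R := by ring
  exact h1.trans (mul_le_mul_of_nonneg_left h3 (Real.rpow_nonneg hm₀.le _))

/-- The clamp onto `[a, b]` is continuous. [folklore] -/
theorem continuous_clamp (a b : ℝ) : Continuous fun t : ℝ => max a (min t b) :=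
  continuous_const.max (continuous_id.min continuous_const)

/-- **Continuous extension of plateau data.**  If `h : ℂ → E` is continuous on an open `U` containing the horizontal segment `[a,b] + iy₀`, then
`t ↦ h (clamp t + iy₀)` is continuous on `ℝ` and agrees with `t ↦ h (t + iy₀)` on `[a,b]`. [folklore] -/
theorem continuous_plateau_clamp {E : Type*} [TopologicalSpace E] {U : Set ℂ} {h : ℂ → E} (hh : ContinuousOn h U)
    {a b y₀ : ℝ} (hab : a ≤ b) (hsub : ∀ t ∈ Icc a b, ((t : ℂ) + (y₀ : ℂ) * Complex.I) ∈ U) :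
    Continuous fun t : ℝ => h (((max a (min t b) : ℝ) : ℂ) + (y₀ : ℂ) * Complex.I) := by
  have hpath : Continuous fun t : ℝ => (((max a (min t b) : ℝ) : ℂ) + (y₀ : ℂ) * Complex.I) :=
    (Complex.continuous_ofReal.comp (continuous_clamp a b)).add continuous_const
  have hrange : ∀ t : ℝ, (((max a (min t b) : ℝ) : ℂ) + (y₀ : ℂ) * Complex.I) ∈ U := fun t => hsub _ ⟨le_max_left _ _, max_le hab (min_le_right _ _)⟩
  exact hh.comp_continuous hpath hrange

/-- Same for vertical connector data `t ↦ h (x₀ + i·clamp t)`. [folklore] -/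
theorem continuous_connector_clamp {E : Type*} [TopologicalSpace E] {U : Set ℂ} {h : ℂ → E} (hh : ContinuousOn h U)
    {a b x₀ : ℝ} (hab : a ≤ b) (hsub : ∀ t ∈ Icc a b, ((x₀ : ℂ) + (t : ℂ) * Complex.I) ∈ U) :
    Continuous fun t : ℝ => h ((x₀ : ℂ) + ((max a (min t b) : ℝ) : ℂ) * Complex.I) := by
  have hpath : Continuous fun t : ℝ => ((x₀ : ℂ) + ((max a (min t b) : ℝ) : ℂ) * Complex.I) :=
    continuous_const.add ((Complex.continuous_ofReal.comp (continuous_clamp a b)).mul continuous_const)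
  have hrange : ∀ t : ℝ, ((x₀ : ℂ) + ((max a (min t b) : ℝ) : ℂ) * Complex.I) ∈ U := fun t => hsub _ ⟨le_max_left _ _, max_le hab (min_le_right _ _)⟩
  exact hh.comp_continuous hpath hrange

end Summit.NavierStokesRegularity.NavierStokesRegularity.Theorems.StadiumMarginKernel

end
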